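import Literature.Computability.Cryptography.ShorOrderFindingQuantum
import Literature.Computability.Cryptography.KitaevModePhaseEstimation
import HarnessLib

/-!
# Kitaev's eigenvalue measurement with a KNOWN modulus: reading the mode index exactly

Topic `Literature/Computability/Cryptography`; support for the discharge of
`VanDamSeroussi2002_gaussSumPhase_qsolvable`. When the measured permutation is the cyclic shift on
`[0, M)` (Kitaev 1995, §5) the eigenphases are `u/M` with `M` KNOWN, so Kitaev's reconstruction
(§3 Lemma 10: quadrant localisation of every `2^l φ` from a cosine and a sine block, then halving
from the top level down — the tree's `Kitaev1995.quadrantCenter`, `Kitaev1995.refined`) followed by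
ROUNDING `M · φ̂` returns the mode index `u` itself, exactly, on every accurate read-out. This is
the classical half of the two eigenvalue measurements of the tree's van Dam–Seroussi circuit (the mode
register of the phase kick-back, `M = p`; the periodised register, `M = 2^N`). One trial; the `kc`
controls carry a level `lvOf j < Lv` (control `j` applies the `2^{lvOf j}`-th power) and a type
`tyOf j` (`true` = sine test); the blocks are the fibres of `(lvOf, tyOf)`, of common size `B`:

* `KitaevRecon.wOf`, `blk`, `cnt`, `levelEst`, `phaseEst`, **`uEst M γ = ⌊M · phaseEst γ⌉ mod M`**;
* `KitaevRecon.W M u γ = Π_j testWeight …` — the Born law of the read-out under mode `u`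
  (`= ‖modeAmp‖²`, `W_eq_norm_sq_modeAmp`); `KitaevRecon.Accurate` (every block count within `B/16`
  of its mean);
* **`uEst_eq_of_accurate`** — if `M · (5/16) < 2^{Lv−1}` then on accurate read-outs `uEst M γ = u`
  (`cdist_refined_le`, `cdist_quadrantCenter_le_bool`, `trigEst_of_cnt`, then rounding:
  `toNat_round_mod_eq`);
* **`sum_W_not_accurate_le`** — the inaccurate read-outs have weight `≤ 2·Lv·64/B` (Chebyshev per
  block, `Kitaev1995.chebyshev_block`, and the union bound `sum_filter_exists_le`), `sum_W_accurate_ge`.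

Everything is proved; the definitions have bodies; no named fact.

## References

* A. Yu. Kitaev, arXiv:quant-ph/9511026 (1995), §3 (Remark 8, the estimate before Lemma 9,
  Lemma 10), §5 [Kitaev1995].
* W. van Dam, G. Seroussi, arXiv:quant-ph/0207131 (2002), §4 [VanDamSeroussi2002].
-/

noncomputable section

open Finset Real

namespace Literature.Computability.Cryptography

namespace KitaevRecon

open Kitaev1995

variable {kc Lv : ℕ} (lvOf : Fin kc → Fin Lv) (tyOf : Fin kc → Bool) (B : ℕ)

/-! ### Controls, counts, estimates -/

/-- Control `j` applies the `2^{lvOf j}`-th power of the shift. [cite: Kitaev1995, §3 Lemma 10] -/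
def wOf (j : Fin kc) : ℕ := 2 ^ (lvOf j : ℕ)

/-- The block of controls of level `l` and type `t`. [folklore] -/
def blk (l : Fin Lv) (t : Bool) : Finset (Fin kc) := univ.filter fun j => lvOf j = l ∧ tyOf j = t

/-- The number of ones read in a block. [cite: Kitaev1995, §3 (before Lemma 9)] -/
def cnt (l : Fin Lv) (t : Bool) (γ : Fin kc → Bool) : ℕ := ((blk lvOf tyOf l t).filter fun j => γ j = true).card

/-- The coarse localisation of `2^l φ` from the signs of the estimated cosine and sine.
[cite: Kitaev1995, §3 Lemma 10] -/
def levelEst (γ : Fin kc → Bool) (l : Fin Lv) : ℚ :=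
  quadrantCenter (decide (2 * cnt lvOf tyOf l false γ ≤ B)) (decide (2 * cnt lvOf tyOf l true γ ≤ B))

/-- The refined estimate of the eigenphase `φ = u/M`. [cite: Kitaev1995, §3 Lemma 10] -/
def phaseEst (γ : Fin kc → Bool) : ℚ :=
  refined (fun l => if h : l < Lv then levelEst lvOf tyOf B γ ⟨l, h⟩ else 0) Lv

/-- **The mode index read off the controls**: `⌊M · φ̂⌉ mod M`. [cite: Kitaev1995, §5] -/
def uEst (M : ℕ) (γ : Fin kc → Bool) : ℕ := ((round ((M : ℚ) * phaseEst lvOf tyOf B γ)) % (M : ℤ)).toNat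

/-! ### The law of the read-out under a mode -/

/-- The weight of outcome `b` of control `j` under mode `u`: `(1 ± trig(2π u 2^l / M))/2`.
[cite: Kitaev1995, §3 Remark 8] -/
def wt (M u : ℕ) (j : Fin kc) (b : Bool) : ℝ := testWeight b (tyOf j) (2 * π * u * wOf lvOf j / M)

/-- **The Born law of the read-out under mode `u`.** [cite: Kitaev1995, §3 Lemma 8] -/
def W (M u : ℕ) (γ : Fin kc → Bool) : ℝ := ∏ j, wt lvOf tyOf M u j (γ j)

/-- The read-out law is the squared modulus of the mode amplitude. [cite: Kitaev1995, §3 Lemma 8] -/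
theorem W_eq_norm_sq_modeAmp (M u : ℕ) (γ : Fin kc → Bool) :
    W lvOf tyOf M u γ = ‖modeAmp tyOf (wOf lvOf) M u γ‖ ^ 2 := by
  rw [norm_sq_modeAmp]; rfl

/-- Test weights are nonnegative. [folklore] -/
theorem wt_nonneg (M u : ℕ) (j : Fin kc) (b : Bool) : 0 ≤ wt lvOf tyOf M u j b := testWeight_nonneg _ _ _

/-- The two outcomes of a test have total weight one. [folklore] -/
theorem wt_false_add_true (M u : ℕ) (j : Fin kc) : wt lvOf tyOf M u j false + wt lvOf tyOf M u j true = 1 :=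
  testWeight_false_add_true _ _

/-- The read-out law is nonnegative. [folklore] -/
theorem W_nonneg (M u : ℕ) (γ : Fin kc → Bool) : 0 ≤ W lvOf tyOf M u γ := prod_nonneg fun j _ => wt_nonneg lvOf tyOf M u j _

/-- The read-out law is a probability distribution. [cite: Kitaev1995, §3 Lemma 8] -/
theorem sum_W (M u : ℕ) : ∑ γ : Fin kc → Bool, W lvOf tyOf M u γ = 1 :=
  sum_prodWeight (fun j b => wt lvOf tyOf M u j b) (wt_false_add_true lvOf tyOf M u)

/-- The success parameter of block `(l, t)`: the weight of `1`. [folklore] -/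
def blkParam (M u : ℕ) (l : Fin Lv) (t : Bool) : ℝ := testWeight true t (2 * π * u * 2 ^ (l : ℕ) / M)

/-- On a block the weights of `1` are constant. [folklore] -/
theorem wt_true_of_mem_blk {M u : ℕ} {l : Fin Lv} {t : Bool} {j : Fin kc} (hj : j ∈ blk lvOf tyOf l t) :
    wt lvOf tyOf M u j true = blkParam M u l t := by
  simp only [blk, mem_filter, mem_univ, true_and] at hj
  obtain ⟨h1, h2⟩ := hj
  rw [wt, blkParam, wOf, h1, h2]
  push_cast
  rfl

/-- The mean number of ones in a block of size `B` is `B · p`. [folklore] -/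
theorem sum_wt_blk {M u : ℕ} {l : Fin Lv} {t : Bool} (hcard : (blk lvOf tyOf l t).card = B) :
    ∑ j ∈ blk lvOf tyOf l t, wt lvOf tyOf M u j true = B * blkParam M u l t := by
  rw [sum_congr rfl fun j hj => wt_true_of_mem_blk lvOf tyOf hj, sum_const, hcard, nsmul_eq_mul]

/-- **Accurate read-outs**: every block count within `B/16` of its mean. [cite: Kitaev1995, §3 (before Lemma 9)] -/
def Accurate (M u : ℕ) (γ : Fin kc → Bool) : Prop :=
  ∀ (l : Fin Lv) (t : Bool), |(cnt lvOf tyOf l t γ : ℝ) - ∑ j ∈ blk lvOf tyOf l t, wt lvOf tyOf M u j true| < B / 16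

/-! ### Accurate read-outs give the mode index -/

variable {lvOf tyOf B}

/-- **Accurate read-outs localise every level**: `cdist (levelEst γ l) (2^l u/M) ≤ 5/32`.
[cite: Kitaev1995, §3 Lemma 10] -/
theorem cdist_levelEst_le {M u : ℕ} {γ : Fin kc → Bool} (hB : 0 < B) (hcard : ∀ l t, (blk lvOf tyOf l t).card = B)
    (hacc : Accurate lvOf tyOf B M u γ) (l : Fin Lv) :
    cdist (levelEst lvOf tyOf B γ l) (2 ^ (l : ℕ) * ((u : ℚ) / M)) ≤ 5 / 32 := by
  have hcos := hacc l false
  have hsin := hacc l true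
  rw [sum_wt_blk lvOf tyOf B (hcard l false)] at hcos
  rw [sum_wt_blk lvOf tyOf B (hcard l true)] at hsin
  simp only [blkParam, testWeight, if_true, if_false, Bool.false_eq_true] at hcos hsin
  set θ : ℝ := 2 * π * u * 2 ^ (l : ℕ) / M with hθ
  obtain ⟨hc1, hc2⟩ := trigEst_of_cnt (c₀ := Real.cos θ) hB hcos
  obtain ⟨hs1, hs2⟩ := trigEst_of_cnt (c₀ := Real.sin θ) hB hsin
  have hθ' : 2 * π * (((2 ^ (l : ℕ) * ((u : ℚ) / M) : ℚ)) : ℝ) = θ := by rw [hθ]; push_cast; ring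
  unfold levelEst
  refine cdist_quadrantCenter_le_bool hc2 hs2 ?_ ?_
  · rw [hθ']; exact hc1
  · rw [hθ']; exact hs1

/-- **Accurate read-outs estimate the eigenphase to within `(5/32)/2^{Lv−1}`.** [cite: Kitaev1995, §3 Lemma 10] -/
theorem cdist_phaseEst_le {M u : ℕ} {γ : Fin kc → Bool} (hB : 0 < B) (hcard : ∀ l t, (blk lvOf tyOf l t).card = B)
    (hLv : 0 < Lv) (hacc : Accurate lvOf tyOf B M u γ) :
    cdist (phaseEst lvOf tyOf B γ) ((u : ℚ) / M) ≤ 5 / 32 / 2 ^ (Lv - 1) := by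
  rw [phaseEst]
  refine cdist_refined_le hLv fun l hl => ?_
  rw [dif_pos hl]
  exact cdist_levelEst_le hB hcard hacc ⟨l, hl⟩

/-- Rounding recovers `u < M` from an approximation of `u/M` modulo integers with error `< 1/(2M)`,
after scaling by `M`. [folklore] -/
theorem toNat_round_mod_eq {M u : ℕ} (hu : u < M) {q : ℚ} (h : cdist q ((u : ℚ) / M) < 1 / (2 * M)) :
    ((round ((M : ℚ) * q)) % (M : ℤ)).toNat = u := by
  have hM : 0 < M := by omega
  have hMq : (0 : ℚ) < M := by exact_mod_cast hM
  obtain ⟨n, hn⟩ := exists_cdist_eq q ((u : ℚ) / M)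
  rw [hn] at h
  -- `|M q − (u + M n)| < 1/2`
  have hlt : |(M : ℚ) * q - ((u : ℤ) + M * n : ℤ)| < 1 / 2 := by
    have : (M : ℚ) * q - ((u : ℤ) + M * n : ℤ) = M * (q - (u : ℚ) / M - n) := by push_cast; field_simp; ring
    rw [this, abs_mul, abs_of_pos hMq]
    calc (M : ℚ) * |q - (u : ℚ) / M - n| < M * (1 / (2 * M)) := mul_lt_mul_of_pos_left h hMq
      _ = 1 / 2 := by field_simp
  have hround : round ((M : ℚ) * q) = (u : ℤ) + M * n := by
    rw [round_eq_iff]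
    obtain ⟨h1, h2⟩ := abs_lt.1 hlt
    constructor <;> linarith
  rw [hround, Int.add_mul_emod_self_left, Int.emod_eq_of_lt (by positivity) (by exact_mod_cast hu), Int.toNat_natCast]

/-- **On accurate read-outs the mode index is read exactly** (`u < M`, `M · (5/16) < 2^{Lv−1}`).
[cite: Kitaev1995, §5 with §3 Lemma 10] -/
theorem uEst_eq_of_accurate {M u : ℕ} (hu : u < M) (hB : 0 < B) (hcard : ∀ l t, (blk lvOf tyOf l t).card = B)
    (hLv : 0 < Lv) (hprec : (M : ℚ) * (5 / 16) < 2 ^ (Lv - 1))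
    {γ : Fin kc → Bool} (hacc : Accurate lvOf tyOf B M u γ) : uEst lvOf tyOf B M γ = u := by
  have hM : (0 : ℚ) < M := by exact_mod_cast (show 0 < M by omega)
  refine toNat_round_mod_eq hu (lt_of_le_of_lt (cdist_phaseEst_le hB hcard hLv hacc) ?_)
  have h2 : (0 : ℚ) < 2 ^ (Lv - 1) := by positivity
  rw [div_lt_div_iff₀ h2 (by positivity)]
  nlinarith

/-! ### The inaccurate read-outs are rare -/

variable (lvOf tyOf B)

/-- **Chebyshev per block**: the read-outs whose count in block `(l, t)` deviates from its mean by at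
least `a > 0` have weight `≤ |blk|/(4a²)`. [cite: Kitaev1995, §3 (the estimate before Lemma 9)] -/
theorem sum_W_deviation_le (M u : ℕ) (l : Fin Lv) (t : Bool) {a : ℝ} (ha : 0 < a) :
    ∑ γ ∈ univ.filter (fun γ : Fin kc → Bool => a ≤ |(cnt lvOf tyOf l t γ : ℝ) - ∑ j ∈ blk lvOf tyOf l t, wt lvOf tyOf M u j true|),
        W lvOf tyOf M u γ ≤ (blk lvOf tyOf l t).card / (4 * a ^ 2) :=
  chebyshev_block (fun (j : Fin kc) b => wt lvOf tyOf M u j b) (fun j b => wt_nonneg lvOf tyOf M u j b)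
    (wt_false_add_true lvOf tyOf M u) (blk lvOf tyOf l t) ha

open scoped Classical in
/-- **The inaccurate read-outs have weight at most `2 · Lv · 64/B`.** [cite: Kitaev1995, §3 (before Lemma 9)] -/
theorem sum_W_not_accurate_le (M u : ℕ) (hB : 0 < B) (hcard : ∀ l t, (blk lvOf tyOf l t).card = B) :
    ∑ γ ∈ univ.filter (fun γ : Fin kc → Bool => ¬ Accurate lvOf tyOf B M u γ), W lvOf tyOf M u γ ≤ 2 * Lv * (64 / B) := by
  have hBr : (0 : ℝ) < B := by exact_mod_cast hB
  -- the bad event is the union over the `2 Lv` blocks of the deviation events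
  have hset : (univ.filter fun γ : Fin kc → Bool => ¬ Accurate lvOf tyOf B M u γ) =
      univ.filter fun γ : Fin kc → Bool => ∃ β : Fin Lv × Bool,
        (B : ℝ) / 16 ≤ |(cnt lvOf tyOf β.1 β.2 γ : ℝ) - ∑ j ∈ blk lvOf tyOf β.1 β.2, wt lvOf tyOf M u j true| := by
    refine filter_congr fun γ _ => ?_
    unfold Accurate
    push Not
    constructor
    · rintro ⟨l, t, h⟩; exact ⟨(l, t), h⟩
    · rintro ⟨β, h⟩; exact ⟨β.1, β.2, h⟩
  rw [hset]
  calc ∑ γ ∈ univ.filter (fun γ : Fin kc → Bool => ∃ β : Fin Lv × Bool,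
          (B : ℝ) / 16 ≤ |(cnt lvOf tyOf β.1 β.2 γ : ℝ) - ∑ j ∈ blk lvOf tyOf β.1 β.2, wt lvOf tyOf M u j true|), W lvOf tyOf M u γ
      ≤ ∑ β : Fin Lv × Bool, ∑ γ ∈ univ.filter (fun γ : Fin kc → Bool =>
          (B : ℝ) / 16 ≤ |(cnt lvOf tyOf β.1 β.2 γ : ℝ) - ∑ j ∈ blk lvOf tyOf β.1 β.2, wt lvOf tyOf M u j true|), W lvOf tyOf M u γ :=
        sum_filter_exists_le _ (W_nonneg lvOf tyOf M u) _
    _ ≤ ∑ β : Fin Lv × Bool, (64 : ℝ) / B := by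
        refine sum_le_sum fun β _ => (sum_W_deviation_le lvOf tyOf M u β.1 β.2 (by positivity : (0 : ℝ) < B / 16)).trans (le_of_eq ?_)
        rw [hcard]
        field_simp
        ring
    _ = 2 * Lv * (64 / B) := by
        rw [sum_const, card_univ, Fintype.card_prod, Fintype.card_fin, Fintype.card_bool, nsmul_eq_mul]
        push_cast; ring

open scoped Classical in
/-- **The accurate read-outs have weight at least `1 − 2·Lv·64/B`.** [cite: Kitaev1995, §3 (before Lemma 9)] -/
theorem sum_W_accurate_ge (M u : ℕ) (hB : 0 < B) (hcard : ∀ l t, (blk lvOf tyOf l t).card = B) :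
    1 - 2 * Lv * (64 / B) ≤ ∑ γ ∈ univ.filter (fun γ : Fin kc → Bool => Accurate lvOf tyOf B M u γ), W lvOf tyOf M u γ := by
  have h := sum_W_not_accurate_le lvOf tyOf B M u hB hcard
  have htot : ∑ γ ∈ univ.filter (fun γ : Fin kc → Bool => Accurate lvOf tyOf B M u γ), W lvOf tyOf M u γ +
      ∑ γ ∈ univ.filter (fun γ : Fin kc → Bool => ¬ Accurate lvOf tyOf B M u γ), W lvOf tyOf M u γ = 1 := by
    rw [sum_filter_add_sum_filter_not, sum_W]
  linarith

end KitaevRecon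

end Literature.Computability.Cryptography

end
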